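import Summits.BirchSwinnertonDyer.BirchSwinnertonDyer.Theses.ByReductionTypeAtTwo
import HarnessLib

/-!
# Route `ByReductionTypeAtTwo` (rung K4): the join `Assembly`, proved by cases

The route's assembly item
`Summit.BirchSwinnertonDyer.BirchSwinnertonDyer.Theses.ByReductionTypeAtTwo.Assembly :=
  GoodOrdinaryRankZeroAtTwo → MultiplicativeRankZeroAtTwo → SupersingularRankZeroAtTwo →
    AdditiveRankZeroAtTwo → RankOneAtTwo →
    Summit.BirchSwinnertonDyer.BirchSwinnertonDyer.Rank1Residual.NonCMAtTwo`
is pure logic over the definitions: for a non-CM globally minimal `W` of analytic rank `≤ 1`,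
either the analytic rank is `1` (item `RankOneAtTwo`) or it is `0`, and then the reduction of `W`
at `2` is good ordinary (`GoodOrd W 2`: good and `2 ∤ a₂`), good supersingular (`GoodSS W 2`: good
and `2 ∣ a₂`), multiplicative (`Mult W 2`) or additive (`Addv W 2 := ¬ good ∧ ¬ multiplicative`),
which are the four rank-`0` items. Nothing is asserted: the five cruxes stay hypotheses of
`Assembly` itself. This is the planner's birth certificate `bc/Assembly_proof.lean` (evidence on
item stmt-BirchSwinnertonDyer-19100, sha16 dd2953ed5695fc4e) with the stand-in `SubStatement`
replaced by the registered leaf constant. [cite: Miller2011LMS, Def 1.1]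
-/

set_option autoImplicit false
set_option linter.dupNamespace false

namespace Summit.BirchSwinnertonDyer.BirchSwinnertonDyer.Theorems

open Summit.BirchSwinnertonDyer.BirchSwinnertonDyer.Theses.ByReductionTypeAtTwo

/-- **The join of route `ByReductionTypeAtTwo` holds**: the five cruxes (BSD₂ for non-CM `E/ℚ` of
analytic rank `0` by reduction type at `2` — good ordinary, multiplicative, good supersingular,
additive — and BSD₂ in analytic rank `1`) imply the rung-K4 leaf `NonCMAtTwo`, by cases on
`W.analyticRank ≤ 1` (`Nat.le_one_iff_eq_zero_or_eq_one`) and on the reduction type of the globally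
minimal model at `2` (good, split by the parity of `a₂`; multiplicative; neither).
[cite: Miller2011LMS, Def 1.1] -/
theorem byReductionTypeAtTwo_assembly_proof :
    Summit.BirchSwinnertonDyer.BirchSwinnertonDyer.Theses.ByReductionTypeAtTwo.Assembly := by
  unfold Summit.BirchSwinnertonDyer.BirchSwinnertonDyer.Theses.ByReductionTypeAtTwo.Assembly
  intro hOrd hMult hSS hAdd hR1 W _ _ hcm hr
  rcases Nat.le_one_iff_eq_zero_or_eq_one.mp hr with h0 | h1
  · by_cases hg : W.HasGoodReductionAtPrime 2
    · by_cases ha : (2 : ℤ) ∣ W.frobeniusTrace 2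
      · exact hSS W hcm h0 ⟨hg, by exact_mod_cast ha⟩
      · exact hOrd W hcm h0 ⟨hg, by exact_mod_cast ha⟩
    · by_cases hm : W.HasMultiplicativeReductionAtPrime 2
      · exact hMult W hcm h0 hm
      · exact hAdd W hcm h0 ⟨hg, hm⟩
  · exact hR1 W hcm h1

end Summit.BirchSwinnertonDyer.BirchSwinnertonDyer.Theorems
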